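/-
  Summits/AtomisticToContinuum/Crystallization/Theorems/OverbindingBudgetAffineFarStraighteningCaps.lean

  residual stmt-AtomisticToContinuum-31280 · slot Z `FarAggregatePricing 12 (1/25) (1/2000) (1/(2·10⁷))` · leaf R_aff′ `AffineChartStraightening'`
  (…FarSlotRecord §1): brick CAPS-1 of the radial-development plan (lens-4 g59 memo NODE-g59-RaffDesign §3, R3 as simplified in the g59 NOTE
  «two-step»): the FIRST-SHELL TWO-STEP LEMMA (exact finite identity of the cuboctahedron / anticuboctahedron) and the DEEP VECTOR.
  decomp-a2c lens-4 «minimal counterexample / extremal reduction», generation 59.  0 sorry · 0 axiom · no instance · no notation · no option.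
  Imports: the tree files `…OverbindingBudgetAffineFarSlotRecord` and `…ChargedEnergyGapChartDialF` (lens-3: the 45° cap lemma, cited by name).
-/
import Summits.AtomisticToContinuum.Crystallization.Theorems.OverbindingBudgetAffineFarSlotRecord
import Summits.AtomisticToContinuum.Crystallization.Theorems.ChargedEnergyGapChartDialF

/-! # CAPS-1 — two-step chains and the deep vector in the inner cap of a two-shell pattern (PROVED)

RADIAL DEVELOPMENT (memo §3 R4): a new site `k` with pulled-back direction `d` and radius `r ≥ 1` is attached to a DEEP placed first-shell
neighbour `p` (level `⟪d,u_k(p)⟫ ≥ ‖d‖/√2`), and consistency with any other PLACED neighbour `j` (level `≥ ‖d‖/(2r) − fuzz ≥ −fuzz`) is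
transported along a chain of placed first-shell neighbours of `k`, consecutive ones adjacent.  A chain of length TWO always exists:

**Two-step identity** (§1, `decide` over the integer models).  For first-shell vectors `v ≠ w` of the fcc / hcp pattern that are NOT adjacent
(`‖v − w‖ ≠ 1`), either `3‖v + w‖² ≤ 1` (the pair is antipodal or at `146.4°`), or there are common unit-neighbours `c₁, c₂` in the first shell
(`‖cᵢ − v‖ = ‖cᵢ − w‖ = 1`, possibly `c₁ = c₂`) with `2(c₁ + c₂) = μ(v + w)` for some `μ ∈ {2, 3, 4}`  (`90°` pairs: the other two vertices of
the square face, `μ = 2`; `120°` pairs: `c₁ = c₂ = v + w`, `μ = 4`; the three hcp `109.47°` up–down pairs: the two hexagon vertices in between,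
`μ = 3`).  Consequently (§3) `⟪d,v⟫ + ⟪d,w⟫ ≤ 2·max ⟪d,cᵢ⟫` as soon as `⟪d,v⟫ + ⟪d,w⟫ > ‖d‖/√3`: the better common neighbour is at least as deep
as the AVERAGE of the pair, so for `p` deep and `j` placed it has level `≥ 0.35‖d‖ − fuzz/2 ≥ ‖d‖/(2r) + 0.1‖d‖` — PLACED WITH MARGIN for every
`r ≥ 1`; and the far pairs cannot occur (`0.707 − fuzz > 1/√3 = 0.577`).  This replaces the cap-connectivity / band-gap statements (C2)(C3) of
`RaffBricks.InnerCapLemma` for first-shell neighbours; the second-shell hook (C4) is CAPS-2 (next file).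
* §1 `TwoStepInt`, `twoStepInt_fcc`, `twoStepInt_hcp` (+ the first-shell selectors `mem_fccInt_of_sqNormInt`, `mem_hcpInt_of_sqNormInt`).
* §2 transport lemmas for scaled integer vectors (norm, distance, sum, inner product).
* §3 `exists_twoStep_scaled` (generic), `exists_twoStep_of_twoShell` (the two-shell patterns).
* §4 `exists_deep_of_twoShell`: for every `d` some FIRST-SHELL `v ∈ P` has `‖d‖ ≤ √2·⟪d, v⟫` (lens-3's cap lemma
  `ChargedEnergyGapChartDial.exists_mem_pattern_inner_ge`, moved to the two-shell patterns).
-/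

namespace Summit.AtomisticToContinuum.Crystallization.Theorems.OverbindingBudgetAffineFarSmoothSplit

open scoped BigOperators RealInnerProductSpace
open Literature.Geometry.DiscreteGeometry (fccTwoShellPattern hcpTwoShellPattern fccKissingPattern hcpKissingPattern scaledPattern intVec
  intVec_apply intVec_sub norm_intVec sqNormInt fccInt hcpInt fccSecondShellInt hcpSecondShellInt sqNormInt_fccInt sqNormInt_hcpInt
  fccKissingPattern_subset hcpKissingPattern_subset norm_eq_one_of_mem_fccKissingPattern norm_eq_one_of_mem_hcpKissingPattern)
open Summit.AtomisticToContinuum.Crystallization.Theorems.ChargedEnergyGapChartDial (exists_mem_pattern_inner_ge)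

/-! ## §1  The integer identities (PROVED, by `decide`) -/

/-- The two-step property of a finite set `S ⊆ ℤ³` of vectors of squared norm `N`: every non-adjacent pair `v ≠ w` (squared distance `≠ N`)
is far (`3‖v + w‖² ≤ N`) or has common neighbours `c₁, c₂ ∈ S` at squared distance `N` from both with `2(c₁ + c₂) = μ(v + w)`, `μ ∈ {2,3,4}`.
[this file] -/
def TwoStepInt (S : Finset (Fin 3 → ℤ)) (N : ℤ) : Prop :=
  ∀ v ∈ S, ∀ w ∈ S, v ≠ w → sqNormInt (v - w) ≠ N →
    3 * sqNormInt (v + w) ≤ N ∨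
      ∃ c₁ ∈ S, ∃ c₂ ∈ S, sqNormInt (c₁ - v) = N ∧ sqNormInt (c₁ - w) = N ∧ sqNormInt (c₂ - v) = N ∧ sqNormInt (c₂ - w) = N ∧
        ∃ μ ∈ ({2, 3, 4} : Finset ℤ), ∀ i : Fin 3, 2 * (c₁ i + c₂ i) = μ * (v i + w i)

/-- **Two-step identity, FCC** (cuboctahedron; integer model `fccInt`, scale `√2`). [this file] -/
theorem twoStepInt_fcc : TwoStepInt fccInt 2 := by
  unfold TwoStepInt
  decide

/-- **Two-step identity, HCP** (anticuboctahedron; integer model `hcpInt`, scale `√18`). [this file] -/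
theorem twoStepInt_hcp : TwoStepInt hcpInt 18 := by
  unfold TwoStepInt
  decide

/-- First-shell selector, FCC: a two-shell integer vector of squared norm `2` is a first-shell vector. [this file] -/
theorem mem_fccInt_of_sqNormInt : ∀ z ∈ fccInt ∪ fccSecondShellInt, sqNormInt z = 2 → z ∈ fccInt := by decide

/-- First-shell selector, HCP: a two-shell integer vector of squared norm `18` is a first-shell vector. [this file] -/
theorem mem_hcpInt_of_sqNormInt : ∀ z ∈ hcpInt ∪ hcpSecondShellInt, sqNormInt z = 18 → z ∈ hcpInt := by decide

/-! ## §2  Transport: scaled integer vectors (PROVED) -/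

-- `intVec_add'` / `sqNormInt_cast_nonneg` are already landed (gate dedup: `…StrictSplittingRuleBirth.bravaisGap_intVec_add`,
-- `Literature.Barriers.AtomisticToContinuum.sqNormInt_nonneg`); their one-line proofs are inlined at the use sites below.

/-- Norm of a scaled integer vector. [folklore] -/
theorem norm_scaled_intVec (N : ℕ) (z : Fin 3 → ℤ) :
    ‖(Real.sqrt N)⁻¹ • intVec z‖ = (Real.sqrt N)⁻¹ * Real.sqrt (sqNormInt z : ℝ) := by
  rw [norm_smul, norm_inv, Real.norm_of_nonneg (Real.sqrt_nonneg _), norm_intVec]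

/-- Distance of two scaled integer vectors. [folklore] -/
theorem dist_scaled_intVec (N : ℕ) (a b : Fin 3 → ℤ) :
    dist ((Real.sqrt N)⁻¹ • intVec a) ((Real.sqrt N)⁻¹ • intVec b) = (Real.sqrt N)⁻¹ * Real.sqrt (sqNormInt (a - b) : ℝ) := by
  rw [dist_eq_norm, ← smul_sub, intVec_sub, norm_scaled_intVec]

/-- Norm of the sum of two scaled integer vectors. [folklore] -/
theorem norm_add_scaled_intVec (N : ℕ) (a b : Fin 3 → ℤ) :
    ‖(Real.sqrt N)⁻¹ • intVec a + (Real.sqrt N)⁻¹ • intVec b‖ = (Real.sqrt N)⁻¹ * Real.sqrt (sqNormInt (a + b) : ℝ) := by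
  rw [← smul_add, show intVec a + intVec b = intVec (a + b) from by ext i; simp [intVec], norm_scaled_intVec]

/-- If `sqNormInt z = N ≠ 0` the scaled vector is a unit vector. [folklore] -/
theorem norm_scaled_eq_one {N : ℕ} (hN : N ≠ 0) {z : Fin 3 → ℤ} (hz : sqNormInt z = N) :
    ‖(Real.sqrt N)⁻¹ • intVec z‖ = 1 := by
  have hpos : (0 : ℝ) < Real.sqrt N := by positivity
  rw [norm_scaled_intVec, hz, Int.cast_natCast, inv_mul_cancel₀ hpos.ne']

/-- If `sqNormInt (a − b) = N ≠ 0` the scaled vectors are at distance `1`. [folklore] -/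
theorem dist_scaled_eq_one {N : ℕ} (hN : N ≠ 0) {a b : Fin 3 → ℤ} (h : sqNormInt (a - b) = N) :
    dist ((Real.sqrt N)⁻¹ • intVec a) ((Real.sqrt N)⁻¹ • intVec b) = 1 := by
  have hpos : (0 : ℝ) < Real.sqrt N := by positivity
  rw [dist_scaled_intVec, h, Int.cast_natCast, inv_mul_cancel₀ hpos.ne']

/-- Conversely, a unit scaled vector has `sqNormInt z = N`. [folklore] -/
theorem sqNormInt_eq_of_norm_scaled_eq_one {N : ℕ} (hN : N ≠ 0) {z : Fin 3 → ℤ}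
    (h : ‖(Real.sqrt N)⁻¹ • intVec z‖ = 1) : sqNormInt z = N := by
  have hpos : (0 : ℝ) < Real.sqrt N := by positivity
  rw [norm_scaled_intVec, inv_mul_eq_iff_eq_mul₀ hpos.ne', mul_one] at h
  have h2 : (sqNormInt z : ℝ) = (N : ℝ) := by
    have := congrArg (fun x => x ^ 2) h
    simpa [Real.sq_sqrt (show (0 : ℝ) ≤ (sqNormInt z : ℝ) by unfold sqNormInt; push_cast; positivity), Real.sq_sqrt (Nat.cast_nonneg N)] using this
  exact_mod_cast h2

/-- The inner product with a scaled integer vector, in coordinates. [folklore] -/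
theorem inner_scaled_intVec (N : ℕ) (d : EuclideanSpace ℝ (Fin 3)) (z : Fin 3 → ℤ) :
    ⟪d, (Real.sqrt N)⁻¹ • intVec z⟫ = (Real.sqrt N)⁻¹ * (d 0 * z 0 + d 1 * z 1 + d 2 * z 2) := by
  rw [real_inner_smul_right]
  congr 1
  rw [real_inner_comm]
  simp [EuclideanSpace.inner_eq_star_dotProduct, dotProduct, Fin.sum_univ_three, intVec_apply]

/-! ## §3  The two-step lemma (PROVED) -/

/-- **Two-step lemma, generic scaled form.**  `S` = first shell (all of squared norm `N`, with the two-step property), `S₂` = the rest;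
for unit points `v ≠ w` of `scaledPattern (S ∪ S₂) N`, not adjacent, and a direction `d` with `⟪d,v⟫ + ⟪d,w⟫ > ‖d‖/√3`, some unit point `c`
of the pattern is adjacent to both and at least as deep as their average: `⟪d,v⟫ + ⟪d,w⟫ ≤ 2⟪d,c⟫`. [this file] -/
theorem exists_twoStep_scaled {S S₂ : Finset (Fin 3 → ℤ)} {N : ℕ} (hN : N ≠ 0)
    (hSnorm : ∀ z ∈ S, sqNormInt z = N) (hfirst : ∀ z ∈ S ∪ S₂, sqNormInt z = N → z ∈ S) (hstep : TwoStepInt S N)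
    {v w d : EuclideanSpace ℝ (Fin 3)} (hv : v ∈ scaledPattern (S ∪ S₂) N) (hv1 : ‖v‖ = 1)
    (hw : w ∈ scaledPattern (S ∪ S₂) N) (hw1 : ‖w‖ = 1) (hne : v ≠ w) (hvw : dist v w ≠ 1)
    (hd : ‖d‖ < Real.sqrt 3 * (⟪d, v⟫ + ⟪d, w⟫)) :
    ∃ c ∈ scaledPattern (S ∪ S₂) N, ‖c‖ = 1 ∧ dist c v = 1 ∧ dist c w = 1 ∧ ⟪d, v⟫ + ⟪d, w⟫ ≤ 2 * ⟪d, c⟫ := by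
  have hpos : (0 : ℝ) < Real.sqrt N := by positivity
  obtain ⟨zv, hzv, rfl⟩ := Finset.mem_image.1 hv
  obtain ⟨zw, hzw, rfl⟩ := Finset.mem_image.1 hw
  have hzvS : zv ∈ S := hfirst zv hzv (sqNormInt_eq_of_norm_scaled_eq_one hN hv1)
  have hzwS : zw ∈ S := hfirst zw hzw (sqNormInt_eq_of_norm_scaled_eq_one hN hw1)
  have hzne : zv ≠ zw := fun h => hne (by rw [h])
  have hnadj : sqNormInt (zv - zw) ≠ (N : ℤ) := fun h => hvw (dist_scaled_eq_one hN h)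
  -- the sum of the two levels is positive
  have hsum_pos : 0 < ⟪d, (Real.sqrt N)⁻¹ • intVec zv⟫ + ⟪d, (Real.sqrt N)⁻¹ • intVec zw⟫ := by
    have h3 : (0 : ℝ) < Real.sqrt 3 := by positivity
    by_contra hle
    push Not at hle
    have : Real.sqrt 3 * (⟪d, (Real.sqrt N)⁻¹ • intVec zv⟫ + ⟪d, (Real.sqrt N)⁻¹ • intVec zw⟫) ≤ 0 :=
      mul_nonpos_of_nonneg_of_nonpos h3.le hle
    linarith [norm_nonneg d]
  rcases hstep zv hzvS zw hzwS hzne hnadj with hfar | ⟨c₁, hc₁, c₂, hc₂, h1v, h1w, h2v, h2w, μ, hμ, hid⟩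
  · -- far pair: `‖v + w‖ ≤ 1/√3`, contradiction with `hd` by Cauchy–Schwarz
    exfalso
    have hvw_norm : ‖(Real.sqrt N)⁻¹ • intVec zv + (Real.sqrt N)⁻¹ • intVec zw‖ ^ 2 ≤ 1 / 3 := by
      rw [norm_add_scaled_intVec, mul_pow, Real.sq_sqrt (show (0 : ℝ) ≤ (sqNormInt _ : ℝ) by unfold sqNormInt; push_cast; positivity), inv_pow, Real.sq_sqrt (Nat.cast_nonneg N)]
      have hN' : (0 : ℝ) < (N : ℝ) := by exact_mod_cast Nat.pos_of_ne_zero hN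
      rw [inv_mul_le_iff₀ hN']
      have : (3 * sqNormInt (zv + zw) : ℝ) ≤ (N : ℝ) := by exact_mod_cast hfar
      linarith
    have hcs := real_inner_le_norm ((Real.sqrt N)⁻¹ • intVec zv + (Real.sqrt N)⁻¹ • intVec zw) d
    rw [real_inner_comm, inner_add_right] at hcs
    -- `(ℓ_v + ℓ_w)² ≤ ‖v+w‖² ‖d‖² ≤ ‖d‖²/3 < (ℓ_v + ℓ_w)²`
    set L := ⟪d, (Real.sqrt N)⁻¹ • intVec zv⟫ + ⟪d, (Real.sqrt N)⁻¹ • intVec zw⟫ with hL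
    have hA : L ^ 2 ≤ ‖(Real.sqrt N)⁻¹ • intVec zv + (Real.sqrt N)⁻¹ • intVec zw‖ ^ 2 * ‖d‖ ^ 2 := by
      rw [← mul_pow]
      exact pow_le_pow_left₀ hsum_pos.le hcs 2
    have hB : L ^ 2 ≤ 1 / 3 * ‖d‖ ^ 2 :=
      hA.trans (mul_le_mul_of_nonneg_right hvw_norm (sq_nonneg _))
    have h3sq : Real.sqrt 3 ^ 2 = 3 := Real.sq_sqrt (by norm_num)
    have hC : ‖d‖ ^ 2 < 3 * L ^ 2 := by
      have h0 : 0 ≤ ‖d‖ := norm_nonneg d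
      have := mul_self_lt_mul_self h0 hd
      nlinarith [h3sq]
    nlinarith
  · -- near pair: common neighbours `c₁, c₂`, identity `2(ℓ₁ + ℓ₂) = μ(ℓ_v + ℓ_w)` with `μ ≥ 2`
    have hμ2 : (2 : ℝ) ≤ (μ : ℝ) := by
      simp only [Finset.mem_insert, Finset.mem_singleton] at hμ
      rcases hμ with rfl | rfl | rfl <;> norm_num
    have hidR : 2 * (⟪d, (Real.sqrt N)⁻¹ • intVec c₁⟫ + ⟪d, (Real.sqrt N)⁻¹ • intVec c₂⟫) =
        (μ : ℝ) * (⟪d, (Real.sqrt N)⁻¹ • intVec zv⟫ + ⟪d, (Real.sqrt N)⁻¹ • intVec zw⟫) := by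
      have e0 : (2 : ℝ) * ((c₁ 0 : ℝ) + c₂ 0) = (μ : ℝ) * ((zv 0 : ℝ) + zw 0) := by exact_mod_cast hid 0
      have e1 : (2 : ℝ) * ((c₁ 1 : ℝ) + c₂ 1) = (μ : ℝ) * ((zv 1 : ℝ) + zw 1) := by exact_mod_cast hid 1
      have e2 : (2 : ℝ) * ((c₁ 2 : ℝ) + c₂ 2) = (μ : ℝ) * ((zv 2 : ℝ) + zw 2) := by exact_mod_cast hid 2
      simp only [inner_scaled_intVec]
      linear_combination (Real.sqrt ↑N)⁻¹ * (d 0 * e0 + d 1 * e1 + d 2 * e2)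
    have hge : ⟪d, (Real.sqrt N)⁻¹ • intVec zv⟫ + ⟪d, (Real.sqrt N)⁻¹ • intVec zw⟫ ≤
        ⟪d, (Real.sqrt N)⁻¹ • intVec c₁⟫ + ⟪d, (Real.sqrt N)⁻¹ • intVec c₂⟫ := by
      nlinarith [hsum_pos, hμ2, hidR]
    have hmem : ∀ c ∈ S, (Real.sqrt N)⁻¹ • intVec c ∈ scaledPattern (S ∪ S₂) N := fun c hc =>
      Finset.mem_image_of_mem _ (Finset.mem_union_left _ hc)
    by_cases h12 : ⟪d, (Real.sqrt N)⁻¹ • intVec c₂⟫ ≤ ⟪d, (Real.sqrt N)⁻¹ • intVec c₁⟫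
    · exact ⟨_, hmem c₁ hc₁, norm_scaled_eq_one hN (hSnorm c₁ hc₁), dist_scaled_eq_one hN h1v, dist_scaled_eq_one hN h1w,
        by linarith⟩
    · exact ⟨_, hmem c₂ hc₂, norm_scaled_eq_one hN (hSnorm c₂ hc₂), dist_scaled_eq_one hN h2v, dist_scaled_eq_one hN h2w,
        by push Not at h12; linarith⟩

/-- **TWO-STEP LEMMA** for the two-shell patterns: for first-shell `v ≠ w ∈ P` not adjacent and a direction `d` with
`⟪d,v⟫ + ⟪d,w⟫ > ‖d‖/√3`, some first-shell `c ∈ P` is adjacent to both with `⟪d,v⟫ + ⟪d,w⟫ ≤ 2⟪d,c⟫`. [this file] -/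
theorem exists_twoStep_of_twoShell {P : Finset (EuclideanSpace ℝ (Fin 3))} (hP : P = fccTwoShellPattern ∨ P = hcpTwoShellPattern)
    {v w d : EuclideanSpace ℝ (Fin 3)} (hv : v ∈ P) (hv1 : ‖v‖ = 1) (hw : w ∈ P) (hw1 : ‖w‖ = 1) (hne : v ≠ w) (hvw : dist v w ≠ 1)
    (hd : ‖d‖ < Real.sqrt 3 * (⟪d, v⟫ + ⟪d, w⟫)) :
    ∃ c ∈ P, ‖c‖ = 1 ∧ dist c v = 1 ∧ dist c w = 1 ∧ ⟪d, v⟫ + ⟪d, w⟫ ≤ 2 * ⟪d, c⟫ := by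
  rcases hP with rfl | rfl
  · have hS : ∀ z ∈ fccInt, sqNormInt z = ((2 : ℕ) : ℤ) := sqNormInt_fccInt
    exact exists_twoStep_scaled two_ne_zero hS mem_fccInt_of_sqNormInt twoStepInt_fcc hv hv1 hw hw1 hne hvw hd
  · have hS : ∀ z ∈ hcpInt, sqNormInt z = ((18 : ℕ) : ℤ) := sqNormInt_hcpInt
    exact exists_twoStep_scaled (by norm_num) hS mem_hcpInt_of_sqNormInt twoStepInt_hcp hv hv1 hw hw1 hne hvw hd

/-! ## §4  The deep vector (PROVED; lens-3's 45° cap lemma moved to the two-shell patterns) -/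

/-- **DEEP VECTOR**: for every `d` some FIRST-SHELL vector `v` of either two-shell pattern has `‖d‖ ≤ √2·⟪d, v⟫` (angle `≤ 45°`).
[ChargedEnergyGapChartDial.exists_mem_pattern_inner_ge; this file] -/
theorem exists_deep_of_twoShell {P : Finset (EuclideanSpace ℝ (Fin 3))} (hP : P = fccTwoShellPattern ∨ P = hcpTwoShellPattern)
    (d : EuclideanSpace ℝ (Fin 3)) : ∃ v ∈ P, ‖v‖ = 1 ∧ ‖d‖ ≤ Real.sqrt 2 * ⟪d, v⟫ := by
  rcases hP with rfl | rfl
  · obtain ⟨v, hv, h⟩ := exists_mem_pattern_inner_ge (Or.inl rfl) d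
    exact ⟨v, fccKissingPattern_subset hv, norm_eq_one_of_mem_fccKissingPattern hv, h⟩
  · obtain ⟨v, hv, h⟩ := exists_mem_pattern_inner_ge (Or.inr rfl) d
    exact ⟨v, hcpKissingPattern_subset hv, norm_eq_one_of_mem_hcpKissingPattern hv, h⟩

end Summit.AtomisticToContinuum.Crystallization.Theorems.OverbindingBudgetAffineFarSmoothSplit
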